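import Summits.HodgeConjecture.HodgeCM.PerL34.Annihilation_1

/-! PORT of `HodgeCM/PerL34/Annihilation.lean` (HodgeCMPerL run 82) — part 2: continuation of `Summits.HodgeConjecture.HodgeCM.PerL34.Annihilation_1` (split at a top-level declaration boundary by port_pkg.py; scope re-opened below; declarations unchanged). -/

-- port_pkg: scope re-opened for this part (file-level context, then the namespace/section stack open at the cut)
set_option autoImplicit false
noncomputable section
namespace HodgeCM
namespace PerL34.Annihilation
open HodgeCM.Prior.Perl34File HodgeCM.Prior.Perl34File.Perl34
open MeasureTheory Filter Topology
local notation "⟪" x ", " y "⟫" => @inner ℂ _ _ x y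
section LayerC
variable {H HG CG G SK SigIdx SigIdxG : Type*}
variable [NormedAddCommGroup H] [InnerProductSpace ℂ H] [CompleteSpace H]
variable [NormedAddCommGroup HG] [InnerProductSpace ℂ HG] [CompleteSpace HG]
variable [NormedAddCommGroup CG] [NormedSpace ℂ CG]
variable [Group G] [TopologicalSpace G] [TopologicalSpace SK]
namespace AnnihilationDatum
variable {C : IsolationCore H HG CG G SK SigIdx SigIdxG} {D : TorusData C}
variable (A : AnnihilationDatum C D)
/-- Step 2 for CONTINUOUS vectors orthogonal to every `E^χ_f`: `P_w (j x) = 0`. -/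
theorem Pw_j_eq_zero (x : A.Cf) (hx : ∀ χ f, ⟪D.E χ f, A.j x⟫ = 0) : D.Pw (A.j x) = 0 := by
  rw [A.Pw_j, A.Pc_eq_zero x hx, map_zero]

end AnnihilationDatum

/-- `𝓔̄^⊥` = the annihilator of all pseudo-Eisenstein vectors, as a submodule (l. 423). -/
def annih {C : IsolationCore H HG CG G SK SigIdx SigIdxG} (D : TorusData C) : Submodule ℂ H where
  carrier := {v | ∀ χ f, ⟪D.E χ f, v⟫ = 0}
  add_mem' := by
    intro u v hu hv χ f
    simp only [Set.mem_setOf_eq] at hu hv ⊢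
    rw [inner_add_right, hu χ f, hv χ f, add_zero]
  zero_mem' := by
    intro χ f
    exact inner_zero_right _
  smul_mem' := by
    intro c v hv χ f
    simp only [Set.mem_setOf_eq] at hv ⊢
    rw [inner_smul_right, hv χ f, mul_zero]

/-- (Ported verbatim from the HodgeCMPerL package; no docstring in the source.) -/
theorem mem_annih {C : IsolationCore H HG CG G SK SigIdx SigIdxG} (D : TorusData C) (v : H) :
    v ∈ annih D ↔ ∀ χ f, ⟪D.E χ f, v⟫ = 0 := Iff.rfl

/-- `𝓔̄^⊥` is closed. -/
theorem annih_closed {C : IsolationCore H HG CG G SK SigIdx SigIdxG} (D : TorusData C) :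
    IsClosed ((annih D : Submodule ℂ H) : Set H) := by
  have h : ((annih D : Submodule ℂ H) : Set H) = ⋂ χ, ⋂ f, {v : H | ⟪D.E χ f, v⟫ = 0} := by
    ext v
    simp only [SetLike.mem_coe, mem_annih, Set.mem_iInter, Set.mem_setOf_eq]
  rw [h]
  exact isClosed_iInter fun χ => isClosed_iInter fun f =>
    isClosed_eq (continuous_const.inner continuous_id) continuous_const

/-- `𝓔̄^⊥` is `R(U(W)(𝔸))`-invariant ("closed invariant subspace", l. 423): by unitarity of `R` and
`R(h₀)E^χ_f = E^χ_{f^{h₀}}` (frozen `AX12_E_transl`, l. 410–411). -/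
theorem annih_invariant {C : IsolationCore H HG CG G SK SigIdx SigIdxG} (D : TorusData C) :
    C.Invariant (annih D) := by
  intro g v hv χ f
  show ⟪D.E χ f, C.R g v⟫ = 0
  have h1 : D.E χ f = C.R g (C.R g⁻¹ (D.E χ f)) := by
    rw [← mul_apply_eq_comp, ← map_mul, mul_inv_cancel, map_one, one_apply_eq_self]
  rw [h1, C.R_unitary, D.AX12_E_transl]
  exact hv χ _

namespace AnnihilationDatum

variable {C : IsolationCore H HG CG G SK SigIdx SigIdxG} {D : TorusData C}

/-- **N23c = PerL v5 Prop 3.6 Step 2 (ll. 423–434)**, in the verbatim shape of the frozen composite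
field `TorusData.AX8_annihilation`: a vector orthogonal to every `E^χ_f` has vanishing `w`-isotypic
part.  KERNEL-PROVED from the labelled fields of `AnnihilationDatum` ("then (𝓔̄^⊥)_w = 0 (P_w bounded,
kills a dense subspace)", l. 434). -/
theorem annihilation (A : AnnihilationDatum C D) (v : H) (hv : ∀ χ f, ⟪D.E χ f, v⟫ = 0) :
    D.Pw v = 0 := by
  have hmem : ∀ n, A.sm n v ∈ annih D :=
    fun n => A.sm_mem (annih D) (annih_closed D) (annih_invariant D) n v hv
  have hzero : ∀ n, D.Pw (A.sm n v) = 0 := by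
    intro n
    obtain ⟨x, hx⟩ := A.sm_cont n v
    rw [← hx]
    refine A.Pw_j_eq_zero x ?_
    intro χ f
    rw [hx]
    exact hmem n χ f
  have hlim : Tendsto (fun n => D.Pw (A.sm n v)) atTop (𝓝 (D.Pw v)) :=
    (D.Pw.continuous.tendsto v).comp (A.sm_tendsto v)
  have hlim0 : Tendsto (fun n => D.Pw (A.sm n v)) atTop (𝓝 (0 : H)) := by
    simp_rw [hzero]
    exact tendsto_const_nhds
  exact tendsto_nhds_unique hlim hlim0

end AnnihilationDatum

end LayerC

end PerL34.Annihilation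

/-! ## The DAG-node statement: N23c from an `AnnihilationDatum` in every context -/

namespace PerL34

open HodgeCM.Prior.Perl34File HodgeCM.Prior.Perl34File.Perl34 HodgeCM.PerL34.Annihilation

/-- **N23c discharged** from the finer data: if every context carries an `AnnihilationDatum` for the
(12) torus side of the model, the landed node statement `N23c_annihilation T`
(`HodgeCM/PerL34/Isolation.lean`) holds — WITHOUT the composite field `AX8_annihilation`
(`#print axioms`: propext, Classical.choice, Quot.sound). -/
theorem N23c_of_annihilationDatum {U : Universe} (T : U.ThetaModel)
    (hA : ∀ {L : CMField} {ι₁ : L →+* ℂ} (V : HermSpace3 L ι₁) (c : SeesawCtx L),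
      Nonempty (AnnihilationDatum (T.core V c) (T.t12 V c))) :
    N23c_annihilation T := by
  intro L ι₁ V c v hv
  obtain ⟨A⟩ := hA V c
  exact A.annihilation v hv

end PerL34

end HodgeCM

end
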